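import Summits.QuantumFields.BalabanUV.Beta.TentQuasiReconstruction1D

/-!
# Beta / TentQuasiReconstruction1DEdges — the 1-D tent along the CYCLIC SUCCESSOR of ℤ/m × Fin n: (1/w)-Lipschitz edge
# differences, at most six tents vary across an edge, total variation ≤ 6n/w (unit `b2b-balaban-beta-d4-p2`, GEN 5, MODEL
# crew; second half of the 1-D data for E-I3 at U = 1, sibling of `TentQuasiReconstruction1D`)

HONEST FRAMING: discharging `BetaPertH` makes Bałaban's UV stability UNCONDITIONAL — NOT the continuum limit, NOT the
Clay problem.  HONEST DEPENDENCY (verbatim): «continuum YM on T⁴ ⇐ BetaPertH ∧ nine spine estimates (0/9 proved);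
BetaPertH ⇐ (D1) ∧ (D4) ∧ CAP+tail; G-an2-4 gates asym, D1 and NE2/3/4.»  THIS MODULE DISCHARGES NOTHING of `BetaPertH`,
asserts NOTHING printed and cites nothing as a fact (ABSOLUTE RULE): [folklore] arithmetic of an explicit piecewise-linear
profile (MODEL).

CONTENT ([folklore]; `m ≥ 3`, `1 ≤ w ≤ n`): `succ` (next offset, or the first site of the next block), `succ_injective`,
`succ_bijective`, `sum_comp_succ`; `prof_last`/`prof_first` (the profile at the two ends of a block); **`abs_tent_succ_sub_le`**
(|tent y (succ x) − tent y x| ≤ 1/w — interior edges by the ramp's Lipschitz constant, block-boundary edges by the four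
matching cases); `ind3` (indicator of the three blocks around y) with `Σ_y = 3`, `Σ_x = 3n`; `abs_tdiff_le_ind`;
**`sum_abs_tdiff_at_le`** (Σ_y ≤ 6/w); **`sum_abs_tdiff_le`** (Σ_x ≤ 6n/w).  Row D4: RECORDS value; class of (I3)/G-B9-15
unchanged; D4 DISCHARGE NO DATE; NOT BetaPertH, NOT continuum, NOT Clay.
-/

namespace Summit.QuantumFields.BalabanUV.Beta.TentQuasiReconstruction1D

open Finset

noncomputable section

variable {m : ℕ} {n : ℕ}

/-! ## §3  The cyclic successor and the edge differences -/

/-- The cyclic successor on ℤ/m × Fin n: next offset, or the first site of the next block. [folklore] -/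
def succ (x : ZMod m × Fin n) : ZMod m × Fin n :=
  if h : x.2.val + 1 < n then (x.1, ⟨x.2.val + 1, h⟩) else (x.1 + 1, ⟨0, by have := x.2.2; omega⟩)

/-- `succ` on a pair, interior case. [folklore] -/
theorem succ_of_lt (b : ZMod m) (j : Fin n) (h : j.val + 1 < n) : succ (b, j) = (b, ⟨j.val + 1, h⟩) := by
  unfold succ; exact dif_pos h

/-- `succ` on a pair, boundary case. [folklore] -/
theorem succ_of_not_lt (b : ZMod m) (j : Fin n) (h : ¬ j.val + 1 < n) :
    succ (b, j) = (b + 1, ⟨0, by have := j.2; omega⟩) := by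
  unfold succ; exact dif_neg h

/-- `succ` is injective. [folklore] -/
theorem succ_injective : Function.Injective (succ (m := m) (n := n)) := by
  rintro ⟨b, j⟩ ⟨b', j'⟩ h
  by_cases hj : j.val + 1 < n <;> by_cases hj' : j'.val + 1 < n
  · rw [succ_of_lt b j hj, succ_of_lt b' j' hj'] at h
    simp only [Prod.mk.injEq, Fin.mk.injEq] at h
    exact Prod.ext h.1 (Fin.ext (by simpa using h.2))
  · rw [succ_of_lt b j hj, succ_of_not_lt b' j' hj'] at h
    simp only [Prod.mk.injEq, Fin.mk.injEq] at h
    exact absurd h.2 (Nat.succ_ne_zero _)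
  · rw [succ_of_not_lt b j hj, succ_of_lt b' j' hj'] at h
    simp only [Prod.mk.injEq, Fin.mk.injEq] at h
    exact absurd h.2.symm (Nat.succ_ne_zero _)
  · rw [succ_of_not_lt b j hj, succ_of_not_lt b' j' hj'] at h
    simp only [Prod.mk.injEq, add_left_inj] at h
    refine Prod.ext h.1 (Fin.ext ?_)
    have h1 := j.2; have h2 := j'.2
    show j.val = j'.val
    omega

/-- `succ` is a bijection (injective self-map of a finite type). [folklore] -/
theorem succ_bijective [NeZero m] [NeZero n] : Function.Bijective (succ (m := m) (n := n)) :=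
  Finite.injective_iff_bijective.mp succ_injective

/-- Sums are invariant under `succ`. [folklore] -/
theorem sum_comp_succ [NeZero m] [NeZero n] (f : ZMod m × Fin n → ℝ) : ∑ x, f (succ x) = ∑ x, f x :=
  Function.Bijective.sum_comp succ_bijective f

/-- The profile at the LAST offset of a block: 1 on the own block, `ramp 1` on the left neighbour, else 0 (`w ≤ n`).
[folklore] -/
theorem prof_last (hm : 3 ≤ m) {w : ℕ} (hw : 1 ≤ w) (hwn : w ≤ n) (δ : ZMod m) (j : Fin n) (hj : j.val + 1 = n) :
    prof n w δ j = if δ = 0 then 1 else if δ = -1 then ramp w 1 else 0 := by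
  unfold prof
  by_cases h0 : δ = 0
  · simp [h0]
  · rw [if_neg h0, if_neg h0]
    by_cases h1 : δ = 1
    · rw [if_pos h1, hj, ramp_eq_zero hw hwn, if_neg (by rw [h1]; exact one_ne_neg_one_zmod hm)]
    · rw [if_neg h1]
      by_cases h2 : δ = -1
      · rw [if_pos h2, if_pos h2, show n - j.val = 1 by omega]
      · rw [if_neg h2, if_neg h2]

/-- The profile at the FIRST offset of a block: 1 on the own block, `ramp 1` on the right neighbour, else 0 (`w ≤ n`).
[folklore] -/
theorem prof_first {w : ℕ} (hw : 1 ≤ w) (hwn : w ≤ n) (δ : ZMod m) (j : Fin n) (hj : j.val = 0) :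
    prof n w δ j = if δ = 0 then 1 else if δ = 1 then ramp w 1 else 0 := by
  unfold prof
  by_cases h0 : δ = 0
  · simp [h0]
  · rw [if_neg h0, if_neg h0]
    by_cases h1 : δ = 1
    · rw [if_pos h1, if_pos h1, hj]
    · rw [if_neg h1, if_neg h1]
      by_cases h2 : δ = -1
      · rw [if_pos h2, hj, Nat.sub_zero, ramp_eq_zero hw hwn]
      · rw [if_neg h2]

/-- **The tent is (1/w)-Lipschitz along the cyclic successor** (`m ≥ 3`, `1 ≤ w ≤ n`). [folklore] -/
theorem abs_tent_succ_sub_le (hm : 3 ≤ m) {w : ℕ} (hw : 1 ≤ w) (hwn : w ≤ n) (y : ZMod m) (x : ZMod m × Fin n) :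
    |tent n w y (succ x) - tent n w y x| ≤ 1 / w := by
  obtain ⟨b, j⟩ := x
  have hw0 : (0 : ℝ) ≤ 1 / w := by positivity
  by_cases hj : j.val + 1 < n
  · -- interior edge: same block, consecutive offsets
    rw [succ_of_lt b j hj]
    unfold tent prof
    simp only
    by_cases h0 : b - y = 0
    · simp [h0]
    · simp only [h0, if_false]
      by_cases h1 : b - y = 1
      · simp only [h1, if_true]
        exact abs_ramp_succ_sub_le hw (j.val + 1)
      · simp only [h1, if_false]
        by_cases h2 : b - y = -1
        · simp only [h2, if_true]
          rw [show n - j.val = (n - (j.val + 1)) + 1 by omega, abs_sub_comm]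
          exact abs_ramp_succ_sub_le hw _
        · simp only [h2, if_false, sub_self, abs_zero]; exact hw0
  · -- boundary edge: last offset of block b to first offset of block b + 1
    rw [succ_of_not_lt b j hj]
    unfold tent
    simp only
    have hjl : j.val + 1 = n := by have := j.2; omega
    rw [prof_first hw hwn (b + 1 - y) _ rfl, prof_last hm hw hwn (b - y) j hjl,
      show b + 1 - y = (b - y) + 1 by ring]
    have hw1 : (1 : ℝ) / w ≤ 1 := (div_le_one (by exact_mod_cast hw)).mpr (by exact_mod_cast hw)
    have hr1 : ramp w 1 = 1 - 1 / w := by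
      unfold ramp; rw [Nat.cast_one]; exact max_eq_right (by linarith)
    set δ := b - y with hδ
    by_cases h0 : δ = 0
    · rw [h0, zero_add, if_neg (one_ne_zero_zmod hm), if_pos rfl, if_pos rfl, hr1]
      rw [show (1 : ℝ) - 1 / w - 1 = -(1 / w) by ring, abs_neg, abs_of_nonneg hw0]
    · by_cases h2 : δ = -1
      · rw [h2, neg_add_cancel, if_pos rfl, if_neg (neg_one_ne_zero_zmod hm), if_pos rfl, hr1]
        rw [show (1 : ℝ) - (1 - 1 / w) = 1 / w by ring, abs_of_nonneg hw0]
      · have h3 : δ + 1 ≠ 0 := fun h => h2 (by linear_combination h)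
        have h4 : δ + 1 ≠ 1 := fun h => h0 (by linear_combination h)
        rw [if_neg h3, if_neg h4, if_neg h0, if_neg h2, sub_self, abs_zero]; exact hw0

/-- MODEL bookkeeping: the indicator of the three blocks around y, by offset. [folklore] -/
def ind3 (δ : ZMod m) : ℝ := (if δ = 0 then (1 : ℝ) else 0) + (if δ = 1 then (1 : ℝ) else 0) + (if δ = -1 then (1 : ℝ) else 0)

/-- `ind3 ≥ 0`. [folklore] -/
theorem ind3_nonneg (δ : ZMod m) : 0 ≤ ind3 δ := by unfold ind3; positivity

/-- `Σ_y ind3 (b − y) = 3`. [folklore] -/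
theorem sum_ind3_sub_left [NeZero m] (b : ZMod m) : ∑ y : ZMod m, ind3 (b - y) = 3 := by
  unfold ind3
  rw [Finset.sum_add_distrib, Finset.sum_add_distrib]
  have e0 : ∑ y : ZMod m, (if b - y = 0 then (1 : ℝ) else 0) = 1 := by
    have : ∀ y : ZMod m, (b - y = 0) ↔ (b = y) := fun y => sub_eq_zero
    simp only [this]; rw [Finset.sum_ite_eq]; simp
  have e1 : ∑ y : ZMod m, (if b - y = 1 then (1 : ℝ) else 0) = 1 := by
    have : ∀ y : ZMod m, (b - y = 1) ↔ (b - 1 = y) := fun y => by constructor <;> intro h <;> linear_combination h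
    simp only [this]; rw [Finset.sum_ite_eq]; simp
  have e2 : ∑ y : ZMod m, (if b - y = -1 then (1 : ℝ) else 0) = 1 := by
    have : ∀ y : ZMod m, (b - y = -1) ↔ (b + 1 = y) := fun y => by constructor <;> intro h <;> linear_combination h
    simp only [this]; rw [Finset.sum_ite_eq]; simp
  rw [e0, e1, e2]; norm_num

/-- `Σ_x ind3 (x.1 − y) = 3n`. [folklore] -/
theorem sum_ind3_sub_right [NeZero m] (y : ZMod m) : ∑ x : ZMod m × Fin n, ind3 (x.1 - y) = 3 * n := by
  rw [Fintype.sum_prod_type]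
  simp only [Finset.sum_const, Finset.card_univ, Fintype.card_fin, nsmul_eq_mul]
  rw [← Finset.mul_sum]
  have : ∑ b : ZMod m, ind3 (b - y) = 3 := by
    unfold ind3
    rw [Finset.sum_add_distrib, Finset.sum_add_distrib]
    have e0 : ∑ b : ZMod m, (if b - y = 0 then (1 : ℝ) else 0) = 1 := by
      have : ∀ b : ZMod m, (b - y = 0) ↔ (y = b) := fun b => by rw [sub_eq_zero, eq_comm]
      simp only [this]; rw [Finset.sum_ite_eq]; simp
    have e1 : ∑ b : ZMod m, (if b - y = 1 then (1 : ℝ) else 0) = 1 := by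
      have : ∀ b : ZMod m, (b - y = 1) ↔ (y + 1 = b) := fun b => by constructor <;> intro h <;> linear_combination -h
      simp only [this]; rw [Finset.sum_ite_eq]; simp
    have e2 : ∑ b : ZMod m, (if b - y = -1 then (1 : ℝ) else 0) = 1 := by
      have : ∀ b : ZMod m, (b - y = -1) ↔ (y - 1 = b) := fun b => by constructor <;> intro h <;> linear_combination -h
      simp only [this]; rw [Finset.sum_ite_eq]; simp
    rw [e0, e1, e2]; norm_num
  rw [this]; ring

/-- The tent vanishes away from the three blocks: `tent y x ≤ ind3 (x.1 − y)` and `tent y x = 0` if `ind3 = 0`. [folklore] -/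
theorem tent_le_ind3 (w : ℕ) (y : ZMod m) (x : ZMod m × Fin n) : tent n w y x ≤ ind3 (x.1 - y) :=
  prof_le_ind3 w _ _

/-- **The edge difference of a tent is ≤ (1/w)·(ind3 at x + ind3 at succ x)** — it vanishes unless one end is near block y.
[folklore] -/
theorem abs_tdiff_le_ind (hm : 3 ≤ m) {w : ℕ} (hw : 1 ≤ w) (hwn : w ≤ n) (y : ZMod m) (x : ZMod m × Fin n) :
    |tent n w y (succ x) - tent n w y x| ≤ 1 / w * (ind3 (x.1 - y) + ind3 ((succ x).1 - y)) := by
  have hw0 : (0 : ℝ) ≤ 1 / w := by positivity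
  by_cases hz : ind3 (x.1 - y) + ind3 ((succ x).1 - y) = 0
  · -- both indicators vanish, so do both tent values
    have h1 : ind3 (x.1 - y) = 0 := by linarith [ind3_nonneg (x.1 - y), ind3_nonneg ((succ x).1 - y)]
    have h2 : ind3 ((succ x).1 - y) = 0 := by linarith [ind3_nonneg (x.1 - y), ind3_nonneg ((succ x).1 - y)]
    have t1 : tent n w y x = 0 := le_antisymm (by rw [← h1]; exact tent_le_ind3 w y x) (tent_nonneg w y x)
    have t2 : tent n w y (succ x) = 0 :=
      le_antisymm (by rw [← h2]; exact tent_le_ind3 w y (succ x)) (tent_nonneg w y (succ x))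
    rw [t1, t2, sub_self, abs_zero, hz, mul_zero]
  · -- otherwise the indicator sum is ≥ 1 (it is a sum of 0/1's)
    have h01 : ∀ δ : ZMod m, ind3 δ = 0 ∨ 1 ≤ ind3 δ := fun δ => by
      unfold ind3; split_ifs <;> norm_num
    have hge : 1 ≤ ind3 (x.1 - y) + ind3 ((succ x).1 - y) := by
      rcases h01 (x.1 - y) with h1 | h1
      · rcases h01 ((succ x).1 - y) with h2 | h2
        · exact absurd (by rw [h1, h2, add_zero]) hz
        · linarith [ind3_nonneg (x.1 - y)]
      · linarith [ind3_nonneg ((succ x).1 - y)]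
    calc |tent n w y (succ x) - tent n w y x| ≤ 1 / w := abs_tent_succ_sub_le hm hw hwn y x
      _ ≤ 1 / w * (ind3 (x.1 - y) + ind3 ((succ x).1 - y)) := le_mul_of_one_le_right hw0 hge

/-- **At most six tents vary across an edge, each by ≤ 1/w**: `Σ_y |tent y (succ x) − tent y x| ≤ 6/w`. [folklore] -/
theorem sum_abs_tdiff_at_le [NeZero m] (hm : 3 ≤ m) {w : ℕ} (hw : 1 ≤ w) (hwn : w ≤ n) (x : ZMod m × Fin n) :
    ∑ y : ZMod m, |tent n w y (succ x) - tent n w y x| ≤ 6 / w := by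
  calc ∑ y : ZMod m, |tent n w y (succ x) - tent n w y x|
      ≤ ∑ y : ZMod m, 1 / w * (ind3 (x.1 - y) + ind3 ((succ x).1 - y)) :=
        Finset.sum_le_sum fun y _ => abs_tdiff_le_ind hm hw hwn y x
    _ = 1 / w * (3 + 3) := by
        rw [← Finset.mul_sum, Finset.sum_add_distrib, sum_ind3_sub_left, sum_ind3_sub_left]
    _ = 6 / w := by ring

/-- **The total variation of a tent along the circle is ≤ 6n/w** (crude: every site of the three blocks around y, and
of their successor-preimages, counted at 1/w). [folklore] -/
theorem sum_abs_tdiff_le [NeZero m] [NeZero n] (hm : 3 ≤ m) {w : ℕ} (hw : 1 ≤ w) (hwn : w ≤ n) (y : ZMod m) :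
    ∑ x : ZMod m × Fin n, |tent n w y (succ x) - tent n w y x| ≤ 6 * n / w := by
  calc ∑ x : ZMod m × Fin n, |tent n w y (succ x) - tent n w y x|
      ≤ ∑ x : ZMod m × Fin n, 1 / w * (ind3 (x.1 - y) + ind3 ((succ x).1 - y)) :=
        Finset.sum_le_sum fun x _ => abs_tdiff_le_ind hm hw hwn y x
    _ = 1 / w * (3 * n + 3 * n) := by
        rw [← Finset.mul_sum, Finset.sum_add_distrib, sum_ind3_sub_right,
          sum_comp_succ (fun x : ZMod m × Fin n => ind3 (x.1 - y)), sum_ind3_sub_right]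
    _ = 6 * n / w := by ring

end

end Summit.QuantumFields.BalabanUV.Beta.TentQuasiReconstruction1D
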